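import Mathlib
import Literature.NumberTheory.LFunctions.Zhang2022.ToolkitBErrorChain
import Literature.NumberTheory.LFunctions.Zhang2022.ToolkitBErrorChainMellin
import Literature.NumberTheory.LFunctions.Zhang2022.ToolkitDivisorMajorants
import HarnessLib

/-!
# Zhang (2022): the coefficient-generic "b-error chain" toolkit, III — the per-block bound of the
# dyadic large-sieve leg (§7.u041 / §14 (14.8) "LegCauchy", generic), assembled

Topic `Literature/NumberTheory/LFunctions/Zhang2022` (Landau–Siegel audit tree; verdict-neutral).
Y. Zhang, *Discrete mean estimates and the Landau–Siegel zero*, arXiv:2211.02515v1 (2022)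
[Zhang2022LandauSiegel] — **an unrefereed manuscript under adjudication**; this THEOREM-ONLY file
asserts nothing about its Theorems 1–2, its Propositions 7.1/14.1, or Landau–Siegel zeros. ZHANG-L
discharge lane, helper block under the leaf `Skeleton.Prop141` (GAP row G-adj2-4; LIB-PLAN §2 B1–B3
assembled; TYPER-PROPOSAL F2 `LegCauchy`; the per-block input of the aggregation B4/`LegLarge`).

The manuscript (§7 p.39, tex L2043–L2058; re-used for (14.8) and (14.6), p.79 tex L3960–L3969):

> By the Mellin transform and Lemma 5.4 (i), `𝔰* ≪ 𝓛ᶜ∫|Σ_l …||Σ_p …|dt/(1+t²)`. For `σ = 1`, by the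
> large sieve inequality [the two mean squares] … It follows by Cauchy's inequality that
> `R^{−3/2} Σ_{R≤r<2R} Σ*_{θ mod r} |𝔰*(R,r,h,d;θ)| ≪ τ₅(d)h𝓛ᶜ(R^{1/2}P^{3/2} + R^{−1/2}P²)`.

Here this per-block bound is PROVED ONCE for the generic localised sum
`𝔰* = BErrorChain.frakSstarGen D c w R r h θ = Σ_{l∈𝔌(Rh),(l,h)=1} c(l)θ(l) Σ_{p∼P} w(p)θ̄(p)Δ(l/(phr))`
(the tree's `ToolkitBErrorChainMellin`), for arbitrary `l`-coefficients with a divisor majorant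
`|c(l)| ≤ K·τ_j(l)` on `𝔌(Rh)` and an arbitrary prime weight `|w(p)| ≤ M`:

* `dyadic_block_bound` — for every `j` there is `C ≥ 0` with, for all large `D`, all such `c, w`,
  all `h ≥ 1`, `1 ≤ R`, `Rh ≤ P`:
  `R^{−3/2} Σ_{R≤r<2R} Σ*_{θ mod r} ‖𝔰*‖ ≤ C·K·M·h·𝓛^{5190+5j²}·(R^{1/2}P^{3/2} + R^{−1/2}P²)`.
  Ingredients, all in the tree: the Mellin step with its factor `hr ≤ 2hR`
  (`BErrorChain.norm_frakSstarGen_le_ellPow`), the two generic large-sieve bounds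
  (`BErrorChain.largeSieve_dyadic_natI_ell`, `largeSieve_dyadic_primeWindow_inv`) and Cauchy's
  inequality inside the `t`-integral (`BErrorChain.sum_le_of_cauchy_integral`), with the shape
  identities `sqrt_largeSieve_main_le`, `rpow_neg_three_halves_mul`.
* `sum_dyadic_prim_norm_sq_lPolyGen_le`, `sum_dyadic_prim_norm_sq_pPolyGen_le` — the two mean squares
  restated for the generic objects `lPolyGen`, `pPolyGen` (pointwise in `t`).

Instances: §7 (7.15) (`c(l) = (κ∗𝐚₁)(dl)`, `K = Bτ₅(d)`, `j = 5`, `w(p) = p^{β₃}`, `M = 1`);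
(14.8) leg `D³ ≤ r < 2DP₄` (`c(l) = κ*(dl)`, `w = χ`); (14.6) (`c(l) = κ*(D₁dl)`); the general-`β`
Proposition 14.1 (`w(p) = χ(p)(pt₀)^β`, `M = e^{5π+1}`). Deliberately NOT here: the aggregation over
`d, h` and the blocks `R` (B4), the `𝔰 ↦ 𝔰*` localisation (in `ToolkitBErrorChainMellin`), any §14
typed object.

## References

* Y. Zhang, arXiv:2211.02515v1 (2022), §7 pp. 38–39, tex L2043–L2058; §14 p. 79, tex L3956–L3969.
  [cite: Zhang2022LandauSiegel, §7 pp.38–39; §14 p.79]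
-/

noncomputable section

open Complex Real MeasureTheory
open Literature.NumberTheory.LFunctions.Zhang2022
open Literature.NumberTheory.LFunctions.Zhang2022.Section7cStatements (natI dyadic)

namespace Literature.NumberTheory.LFunctions.Zhang2022.BErrorChain

open Skeleton

/-! ## The two mean squares for the generic objects -/

open scoped Classical in
/-- **The `l`-mean square for `lPolyGen`** (§7.u039 generic): for `D ≥ 3`, `1 ≤ R`, `h ≥ 1`,
`Rh ≤ P`, `|c(l)| ≤ Kτ_j(l)` on `𝔌(Rh)`, and every real `t`,
`Σ_{R≤r<2R} Σ*_{θ mod r} ‖lPolyGen(1+it)‖² ≤ 114·525^{j²}·majorantConst(j²,2j)·K²·𝓛^{9j²}`.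
[cite: Zhang2022LandauSiegel, §7 p.39, tex L2047] -/
theorem sum_dyadic_prim_norm_sq_lPolyGen_le {D : ℕ} (hD : 3 ≤ D) {R K : ℝ} {h : ℕ} (hR : 1 ≤ R)
    (hh : 0 < h) (hRhP : R * h ≤ bigP D) (j : ℕ) {c : ℕ → ℂ}
    (hc : ∀ l ∈ natI D (R * h), ‖c l‖ ≤ K * MeanSquareMajorant.tau j l) (t : ℝ) :
    (∑ r ∈ dyadic R, ∑ θ : DirichletCharacter ℂ r with θ.IsPrimitive,
        ‖lPolyGen D c R r h θ (1 + t * I)‖ ^ 2) ≤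
      114 * 525 ^ (j ^ 2) * MeanSquareMajorant.majorantConst (j ^ 2) (2 * j) * K ^ 2 *
        ell D ^ (9 * j ^ 2) := by
  have hh1 : (1 : ℝ) ≤ h := by exact_mod_cast hh
  have hRy : R ≤ R * h := le_mul_of_one_le_right (by linarith) hh1
  have hs : (1 + (t : ℂ) * I).re = 1 := by simp
  have h1 := largeSieve_dyadic_natI_ell hD hR hRy hRhP j hc
    (S := (natI D (R * h)).filter (fun l => Nat.Coprime l h)) (Finset.filter_subset _ _) hs
  exact h1

open scoped Classical in
/-- **The `p`-mean square for `pPolyGen`** (§7.u040 generic): for `D ≥ 3`, `1 ≤ R`, `|w(p)| ≤ M` on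
the window, and every real `t`, `Σ_{R≤r<2R} Σ*_{θ mod r} ‖pPolyGen(1+it)‖² ≤ 486·M²·(R² + P)·P³`.
[cite: Zhang2022LandauSiegel, §7 p.39, tex L2051] -/
theorem sum_dyadic_prim_norm_sq_pPolyGen_le {D : ℕ} (hD : 3 ≤ D) {R M : ℝ} (hR : 1 ≤ R)
    (hM : 0 ≤ M) {w : ℕ → ℂ} (hw : ∀ p ∈ primeWindow D, ‖w p‖ ≤ M) (t : ℝ) :
    (∑ r ∈ dyadic R, ∑ θ : DirichletCharacter ℂ r with θ.IsPrimitive,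
        ‖pPolyGen D w r θ (1 + t * I)‖ ^ 2) ≤
      486 * M ^ 2 * (R ^ 2 + bigP D) * bigP D ^ 3 := by
  set b : ℕ → ℂ := fun p => w p * (p : ℂ) ^ (1 + (t : ℂ) * I) with hb
  have hbM : ∀ p ∈ primeWindow D, ‖b p‖ ≤ M * p := by
    intro p hp
    have hp0 : 0 < p := (Finset.mem_filter.mp hp).2.pos
    simp only [hb]
    rw [norm_mul, Complex.norm_natCast_cpow_of_pos hp0]
    simp only [Complex.add_re, Complex.one_re, Complex.mul_re, Complex.ofReal_re, Complex.I_re,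
      Complex.ofReal_im, Complex.I_im, mul_zero, sub_zero, mul_one, add_zero, Real.rpow_one]
    exact mul_le_mul_of_nonneg_right (hw p hp) (Nat.cast_nonneg p)
  have h1 := largeSieve_dyadic_primeWindow_inv hD hR hM b hbM
  have heq : ∀ (r : ℕ) (θ : DirichletCharacter ℂ r),
      pPolyGen D w r θ (1 + t * I) = ∑ p ∈ primeWindow D, b p * θ⁻¹ (p : ZMod r) := by
    intro r θ
    unfold pPolyGen
    exact Finset.sum_congr rfl fun p _ => by simp only [hb]; ring
  simp_rw [heq]
  exact h1

/-! ## The per-block bound -/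

open scoped Classical in
/-- The filter-form double sum `Σ_{R≤r<2R} Σ*_θ` as one sum over the finite set of pairs `(r, θ)`.
[cite: Zhang2022LandauSiegel, §7 (7.15) p.38, tex L2025] -/
theorem sum_filter_prim_eq_sum_sigma (R : ℝ) (v : (r : ℕ) → DirichletCharacter ℂ r → ℝ) :
    (∑ r ∈ dyadic R, ∑ θ : DirichletCharacter ℂ r with θ.IsPrimitive, v r θ) =
      ∑ x ∈ (dyadic R).sigma (fun r =>
          (Finset.univ : Finset (DirichletCharacter ℂ r)).filter fun θ => θ.IsPrimitive),
        v x.1 x.2 := by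
  rw [Finset.sum_sigma]

/-- `(R² + P)P³ ≤ (R·P^{3/2} + P²)²` (`R, P ≥ 0`). [cite: Zhang2022LandauSiegel, §7 p.39, tex L2055] -/
theorem largeSieve_main_le_sq {R P : ℝ} (hR : 0 ≤ R) (hP : 0 ≤ P) :
    (R ^ 2 + P) * P ^ 3 ≤ (R * P ^ (3 / 2 : ℝ) + P ^ 2) ^ 2 := by
  have h := sqrt_largeSieve_main_le hR hP
  have h0 : 0 ≤ (R ^ 2 + P) * P ^ 3 := by positivity
  have h1 : 0 ≤ R * P ^ (3 / 2 : ℝ) + P ^ 2 := by positivity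
  calc (R ^ 2 + P) * P ^ 3 = Real.sqrt ((R ^ 2 + P) * P ^ 3) ^ 2 := (Real.sq_sqrt h0).symm
    _ ≤ (R * P ^ (3 / 2 : ℝ) + P ^ 2) ^ 2 := pow_le_pow_left₀ (Real.sqrt_nonneg _) h 2

open scoped Classical in
/-- **The per-block bound of the dyadic large-sieve leg, generic coefficients** (§7.u041 first bound
/ §14 (14.8) `LegCauchy`): for every `j` there is `C ≥ 0` such that for all large `D`, for all
coefficient sequences `c` with `|c(l)| ≤ K·τ_j(l)` on `𝔌(Rh)` (`K ≥ 0`), all prime weights `w` with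
`|w(p)| ≤ M` on `p ∼ P` (`M ≥ 0`), all `h ≥ 1` and all `R` with `1 ≤ R`, `Rh ≤ P`:
`R^{−3/2} Σ_{R≤r<2R} Σ*_{θ mod r} ‖𝔰*(R,r,h;θ)‖ ≤ C·K·M·h·𝓛^{5190+5j²}·(R^{1/2}P^{3/2} + R^{−1/2}P²)`.
(Mellin step with the factor `hr ≤ 2hR`; the two large sieves pointwise in `t`; Cauchy's inequality
in `(r,θ)` inside `∫dt/(1+t²)`; `√((R²+P)P³) ≤ RP^{3/2} + P²`; `𝓛^{9j²} ≤ 𝓛^{10j²}`.)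
[cite: Zhang2022LandauSiegel, §7 p.39, tex L2055; §14 p.79, tex L3962] -/
theorem dyadic_block_bound (j : ℕ) :
    ∃ C : ℝ, 0 ≤ C ∧ ForAllLarge fun D _ _ =>
      ∀ (c w : ℕ → ℂ) (K M R : ℝ) (h : ℕ), 0 ≤ K → 0 ≤ M →
        (∀ l ∈ natI D (R * h), ‖c l‖ ≤ K * MeanSquareMajorant.tau j l) →
        (∀ p ∈ primeWindow D, ‖w p‖ ≤ M) →
        0 < h → 1 ≤ R → R * h ≤ bigP D →
          R ^ (-(3 / 2 : ℝ)) * ∑ r ∈ dyadic R, ∑ θ : DirichletCharacter ℂ r with θ.IsPrimitive,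
              ‖frakSstarGen D c w R r h θ‖ ≤
            C * K * M * (h : ℝ) * ell D ^ (5190 + 5 * j ^ 2) *
              (R ^ (1 / 2 : ℝ) * bigP D ^ (3 / 2 : ℝ) + R ^ (-(1 / 2 : ℝ)) * bigP D ^ 2) := by
  set Ca : ℝ := 114 * 525 ^ (j ^ 2) * MeanSquareMajorant.majorantConst (j ^ 2) (2 * j) with hCa
  have hCa0 : 0 ≤ Ca := by
    have := MeanSquareMajorant.majorantConst_pos (j ^ 2) (2 * j)
    rw [hCa]; positivity
  set C : ℝ := Real.pi * (K54 * (1 / (2 * Real.pi))) * 2 * Real.sqrt Ca * Real.sqrt 486 with hC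
  have hK54 : 0 ≤ K54 := K54_nonneg
  have hC0 : 0 ≤ C := by rw [hC]; positivity
  obtain ⟨D₁, hMel⟩ := norm_frakSstarGen_le_ellPow
  refine ⟨C, hC0, max D₁ 3, fun D _ χ hD hq hp c w K M R h hK hM hc hw hh hR hRhP => ?_⟩
  have hD3 : 3 ≤ D := le_trans (le_max_right _ _) hD
  have hMelD := hMel D χ (le_trans (le_max_left _ _) hD) hq hp
  have hℓ1 : 1 ≤ ell D := one_le_ell hD3
  set P := bigP D with hPdef
  have hP1 : 1 ≤ P := one_le_bigP D
  have hP0 : 0 ≤ P := by linarith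
  have hR0 : 0 < R := by linarith
  have hh1 : (1 : ℝ) ≤ h := by exact_mod_cast hh
  set L := ell D with hLdef
  -- the index set and the three families
  set T : Finset (Σ r : ℕ, DirichletCharacter ℂ r) := (dyadic R).sigma fun r =>
      (Finset.univ : Finset (DirichletCharacter ℂ r)).filter fun θ => θ.IsPrimitive with hTdef
  set F : (Σ r : ℕ, DirichletCharacter ℂ r) → ℝ → ℝ :=
    fun x t => ‖lPolyGen D c R x.1 h x.2 (1 + t * I)‖ with hFdef
  set G : (Σ r : ℕ, DirichletCharacter ℂ r) → ℝ → ℝ :=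
    fun x t => ‖pPolyGen D w x.1 x.2 (1 + t * I)‖ with hGdef
  set v : (Σ r : ℕ, DirichletCharacter ℂ r) → ℝ := fun x => ‖frakSstarGen D c w R x.1 h x.2‖
    with hvdef
  set W : ℝ := K54 * (1 / (2 * Real.pi)) * L ^ 5190 * (2 * (h : ℝ) * R) with hWdef
  set A : ℝ := Real.sqrt Ca * K * L ^ (5 * j ^ 2) with hAdef
  set B : ℝ := Real.sqrt 486 * M * (R * P ^ (3 / 2 : ℝ) + P ^ 2) with hBdef
  have hL0 : 0 ≤ L := le_trans zero_le_one hℓ1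
  have hW0 : 0 ≤ W := by rw [hWdef]; positivity
  have hA0 : 0 ≤ A := by rw [hAdef]; positivity
  have hB0 : 0 ≤ B := by rw [hBdef]; positivity
  -- members of the block are positive moduli with `hr ≤ 2hR`
  have hrpos : ∀ x ∈ T, 0 < x.1 := by
    intro x hx
    have hr : x.1 ∈ dyadic R := (Finset.mem_sigma.mp hx).1
    have h1 : (1 : ℝ) ≤ x.1 := le_trans hR (mem_dyadic hr).1
    exact_mod_cast (show (0 : ℝ) < x.1 by linarith)
  -- (1) the pointwise Mellin bound with `hr ≤ 2hR`
  have hv : ∀ x ∈ T, v x ≤ W * ∫ t : ℝ, F x t * G x t / (1 + t ^ 2) := by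
    intro x hx
    have hr : x.1 ∈ dyadic R := (Finset.mem_sigma.mp hx).1
    obtain ⟨-, hle⟩ := hMelD c w R x.1 h x.2 (hrpos x hx) hh
    have hI0 : 0 ≤ ∫ t : ℝ, F x t * G x t / (1 + t ^ 2) :=
      integral_nonneg fun t => by simp only [hFdef, hGdef]; positivity
    have hhr : ((h * x.1 : ℕ) : ℝ) ≤ 2 * (h : ℝ) * R := by
      have h2 := (mem_dyadic hr).2
      push_cast
      nlinarith [h2, hh1]
    calc v x ≤ K54 * (1 / (2 * π)) * ell D ^ 5190 * ((h * x.1 : ℕ) : ℝ) *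
          ∫ t : ℝ, F x t * G x t / (1 + t ^ 2) := hle
      _ ≤ K54 * (1 / (2 * π)) * ell D ^ 5190 * (2 * (h : ℝ) * R) *
          ∫ t : ℝ, F x t * G x t / (1 + t ^ 2) := by
          gcongr
      _ = W * ∫ t : ℝ, F x t * G x t / (1 + t ^ 2) := by rw [hWdef]
  -- (2) the `l`-mean square is at most `A²`
  have hFA : ∀ t : ℝ, ∑ x ∈ T, F x t ^ 2 ≤ A ^ 2 := by
    intro t
    have h1 := sum_dyadic_prim_norm_sq_lPolyGen_le hD3 hR hh hRhP j hc t
    rw [sum_filter_prim_eq_sum_sigma] at h1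
    have hpow : L ^ (9 * j ^ 2) ≤ L ^ (10 * j ^ 2) := pow_le_pow_right₀ hℓ1 (by omega)
    have hA2 : A ^ 2 = Ca * K ^ 2 * L ^ (10 * j ^ 2) := by
      rw [hAdef, mul_pow, mul_pow, Real.sq_sqrt hCa0, ← pow_mul]
      ring_nf
    calc ∑ x ∈ T, F x t ^ 2 ≤ Ca * K ^ 2 * L ^ (9 * j ^ 2) := by
          simpa only [hCa, hFdef, mul_assoc] using h1
      _ ≤ Ca * K ^ 2 * L ^ (10 * j ^ 2) := by gcongr
      _ = A ^ 2 := hA2.symm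
  -- (3) the `p`-mean square is at most `B²`
  have hGB : ∀ t : ℝ, ∑ x ∈ T, G x t ^ 2 ≤ B ^ 2 := by
    intro t
    have h1 := sum_dyadic_prim_norm_sq_pPolyGen_le hD3 hR hM hw t
    rw [sum_filter_prim_eq_sum_sigma] at h1
    have hB2 : B ^ 2 = 486 * M ^ 2 * (R * P ^ (3 / 2 : ℝ) + P ^ 2) ^ 2 := by
      rw [hBdef, mul_pow, mul_pow, Real.sq_sqrt (by norm_num : (0 : ℝ) ≤ 486)]
    calc ∑ x ∈ T, G x t ^ 2 ≤ 486 * M ^ 2 * (R ^ 2 + P) * P ^ 3 := h1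
      _ = 486 * M ^ 2 * ((R ^ 2 + P) * P ^ 3) := by ring
      _ ≤ 486 * M ^ 2 * (R * P ^ (3 / 2 : ℝ) + P ^ 2) ^ 2 :=
          mul_le_mul_of_nonneg_left (largeSieve_main_le_sq hR0.le hP0) (by positivity)
      _ = B ^ 2 := hB2.symm
  -- (4) continuity and non-negativity
  have hFc : ∀ x ∈ T, Continuous (F x) := fun x _ =>
    (continuous_lPolyGen_line D c R x.1 h x.2).1.norm
  have hGc : ∀ x ∈ T, Continuous (G x) := fun x _ =>
    (continuous_pPolyGen_line D w x.1 x.2).1.norm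
  have hF0 : ∀ x ∈ T, ∀ t, 0 ≤ F x t := fun x _ t => norm_nonneg _
  have hG0 : ∀ x ∈ T, ∀ t, 0 ≤ G x t := fun x _ t => norm_nonneg _
  -- (5) Cauchy inside the integral
  have hsum : ∑ x ∈ T, v x ≤ Real.pi * W * A * B :=
    sum_le_of_cauchy_integral T F G v hW0 hA0 hB0 hFc hGc hF0 hG0 hFA hGB hv
  -- (6) assemble
  have hlhs : (∑ r ∈ dyadic R, ∑ θ : DirichletCharacter ℂ r with θ.IsPrimitive,
      ‖frakSstarGen D c w R r h θ‖) = ∑ x ∈ T, v x := by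
    rw [hTdef, hvdef]
    exact sum_filter_prim_eq_sum_sigma R (fun r θ => ‖frakSstarGen D c w R r h θ‖)
  have hR32 : 0 ≤ R ^ (-(3 / 2 : ℝ)) := Real.rpow_nonneg hR0.le _
  have hshape := rpow_neg_three_halves_mul (P := P) hR0
  calc R ^ (-(3 / 2 : ℝ)) * ∑ r ∈ dyadic R, ∑ θ : DirichletCharacter ℂ r with θ.IsPrimitive,
        ‖frakSstarGen D c w R r h θ‖
      = R ^ (-(3 / 2 : ℝ)) * ∑ x ∈ T, v x := by rw [hlhs]
    _ ≤ R ^ (-(3 / 2 : ℝ)) * (Real.pi * W * A * B) := mul_le_mul_of_nonneg_left hsum hR32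
    _ = C * K * M * (h : ℝ) * (L ^ 5190 * L ^ (5 * j ^ 2)) *
          (R ^ (-(3 / 2 : ℝ)) * R * (R * P ^ (3 / 2 : ℝ) + P ^ 2)) := by
        rw [hWdef, hAdef, hBdef, hC]; ring
    _ = C * K * M * (h : ℝ) * L ^ (5190 + 5 * j ^ 2) *
          (R ^ (1 / 2 : ℝ) * P ^ (3 / 2 : ℝ) + R ^ (-(1 / 2 : ℝ)) * P ^ 2) := by
        rw [hshape, ← pow_add]

/-! ## From `𝔰*` to the full series `𝔰` (the `l ∉ 𝔌(Rh)` terms are negligible) -/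

/-- There are `φ(r)` Dirichlet characters modulo `r ≥ 1` with complex values.
[cite: Zhang2022LandauSiegel, §2 p.4] -/
private theorem card_dirichletCharacter_eq_totient (r : ℕ) [NeZero r] :
    Fintype.card (DirichletCharacter ℂ r) = r.totient := by
  classical
  haveI : NeZero ((Monoid.exponent (ZMod r)ˣ : ℕ) : ℂ) :=
    ⟨Nat.cast_ne_zero.mpr Monoid.exponent_ne_zero_of_finite⟩
  rw [← Nat.card_eq_fintype_card]
  exact DirichletCharacter.card_eq_totient_of_hasEnoughRootsOfUnity ℂ r

open scoped Classical in
/-- The number of pairs `(r, θ)`, `R ≤ r < 2R`, `θ` primitive mod `r`, is at most `6R²` (`R ≥ 1`):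
each `r` carries `φ(r) ≤ r < 2R` characters and the block has at most `⌈2R⌉ ≤ 3R` moduli.
[cite: Zhang2022LandauSiegel, §7 (7.15) p.38, tex L2025] -/
theorem card_sigma_dyadic_prim_le {R : ℝ} (hR : 1 ≤ R) :
    (((dyadic R).sigma fun r =>
        (Finset.univ : Finset (DirichletCharacter ℂ r)).filter fun θ => θ.IsPrimitive).card : ℝ) ≤
      6 * R ^ 2 := by
  rw [Finset.card_sigma, Nat.cast_sum]
  have hterm : ∀ r ∈ dyadic R,
      (((Finset.univ : Finset (DirichletCharacter ℂ r)).filter fun θ => θ.IsPrimitive).card : ℝ) ≤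
        2 * R := by
    intro r hr
    obtain ⟨hRr, hr2⟩ := mem_dyadic hr
    have hr1 : 1 ≤ r := by exact_mod_cast (le_trans hR hRr)
    haveI : NeZero r := ⟨by omega⟩
    calc (((Finset.univ : Finset (DirichletCharacter ℂ r)).filter fun θ => θ.IsPrimitive).card : ℝ)
        ≤ (Fintype.card (DirichletCharacter ℂ r) : ℝ) := by
          exact_mod_cast Finset.card_filter_le _ _ |>.trans (Finset.card_univ (α := DirichletCharacter ℂ r)).le
      _ = (r.totient : ℝ) := by rw [card_dirichletCharacter_eq_totient]
      _ ≤ r := by exact_mod_cast Nat.totient_le r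
      _ ≤ 2 * R := hr2.le
  have hcard : ((dyadic R).card : ℝ) ≤ 3 * R := by
    have h1 : (dyadic R).card ≤ ⌈2 * R⌉₊ := by
      calc (dyadic R).card ≤ (Finset.range ⌈2 * R⌉₊).card := Finset.card_filter_le _ _
        _ = ⌈2 * R⌉₊ := Finset.card_range _
    calc ((dyadic R).card : ℝ) ≤ ⌈2 * R⌉₊ := by exact_mod_cast h1
      _ ≤ 2 * R + 1 := (Nat.ceil_lt_add_one (by linarith)).le
      _ ≤ 3 * R := by linarith
  calc ∑ r ∈ dyadic R,
        (((Finset.univ : Finset (DirichletCharacter ℂ r)).filter fun θ => θ.IsPrimitive).card : ℝ)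
      ≤ ∑ _r ∈ dyadic R, 2 * R := Finset.sum_le_sum hterm
    _ = (dyadic R).card * (2 * R) := by rw [Finset.sum_const, nsmul_eq_mul]
    _ ≤ 3 * R * (2 * R) := by gcongr
    _ = 6 * R ^ 2 := by ring

open scoped Classical in
/-- **The per-block bound for the full series `𝔰 = frakSGen`** (the shape the §14 aggregation B4
consumes): for every `j` there is `C ≥ 0` such that for all large `D`, for all `c` with
`|c(l)| ≤ K·τ_j(l)` on `𝔌(Rh)` AND `|c(l)| ≤ B·(dl)⁴` for all `l` (`K ≥ 0`; the polynomial majorant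
feeds the localisation `𝔰 ↦ 𝔰*`, the tree's `BErrorChain.norm_frakSGen_sub_frakSstarGen_le`), all
`w` with `|w(p)| ≤ M` on the window (`M ≥ 0`), `1 ≤ d ≤ P`, `h ≥ 1`, `1 ≤ R`, `Rh ≤ P`:
`R^{−3/2} Σ_{R≤r<2R} Σ*_{θ mod r} ‖𝔰(r,h;θ)‖
  ≤ (C·K·M·h·𝓛^{5190+5j²} + 6·B·M)·(R^{1/2}P^{3/2} + R^{−1/2}P²)`
(the `≤ 6R²` discarded tails, each `≤ BMe^{−c₁𝓛¹⁰} ≤ BM`, against `R^{−3/2}·6R² = 6R^{1/2} ≤ 6R^{1/2}P^{3/2}`).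
[cite: Zhang2022LandauSiegel, §7 pp.38–39, tex L2036–L2058; §14 p.79, tex L3962] -/
theorem dyadic_block_bound_frakSGen (j : ℕ) :
    ∃ C : ℝ, 0 ≤ C ∧ ForAllLarge fun D _ _ =>
      ∀ (c w : ℕ → ℂ) (K M B : ℝ) (d : ℕ) (R : ℝ) (h : ℕ), 0 ≤ K → 0 ≤ M →
        (∀ l ∈ natI D (R * h), ‖c l‖ ≤ K * MeanSquareMajorant.tau j l) →
        (∀ l : ℕ, ‖c l‖ ≤ B * ((d * l : ℕ) : ℝ) ^ 4) →
        (∀ p ∈ primeWindow D, ‖w p‖ ≤ M) →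
        0 < d → (d : ℝ) ≤ bigP D → 0 < h → 1 ≤ R → R * h ≤ bigP D →
          R ^ (-(3 / 2 : ℝ)) * ∑ r ∈ dyadic R, ∑ θ : DirichletCharacter ℂ r with θ.IsPrimitive,
              ‖frakSGen D c w r h θ‖ ≤
            (C * K * M * (h : ℝ) * ell D ^ (5190 + 5 * j ^ 2) + 6 * B * M) *
              (R ^ (1 / 2 : ℝ) * bigP D ^ (3 / 2 : ℝ) + R ^ (-(1 / 2 : ℝ)) * bigP D ^ 2) := by
  obtain ⟨C, hC0, D₁, hblock⟩ := dyadic_block_bound j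
  obtain ⟨c₁, hc₁, D₂, htrunc⟩ := norm_frakSGen_sub_frakSstarGen_le
  refine ⟨C, hC0, max D₁ D₂, fun D _ χ hD hq hp c w K M B d R h hK hM hc hc4 hw hd hdP hh hR hRhP => ?_⟩
  have hblk := hblock D χ (le_trans (le_max_left _ _) hD) hq hp c w K M R h hK hM hc hw hh hR hRhP
  have htr := htrunc D χ (le_trans (le_max_right _ _) hD) hq hp
  set P := bigP D with hPdef
  have hP1 : 1 ≤ P := one_le_bigP D
  have hR0 : 0 < R := by linarith
  have hhR : (h : ℝ) * R ≤ bigP D := by rw [mul_comm]; exact hRhP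
  -- `B ≥ 0` (from `l = 1`: `‖c 1‖ ≤ B·d⁴` and `‖c 1‖ ≥ 0`)
  have hB0 : 0 ≤ B := by
    have h1 := (norm_nonneg _).trans (hc4 1)
    have h2 : (0 : ℝ) < ((d * 1 : ℕ) : ℝ) ^ 4 := by positivity
    nlinarith
  -- termwise: `‖𝔰‖ ≤ ‖𝔰*‖ + BM`
  have hterm : ∀ r ∈ dyadic R, ∀ θ : DirichletCharacter ℂ r,
      ‖frakSGen D c w r h θ‖ ≤ ‖frakSstarGen D c w R r h θ‖ + B * M := by
    intro r hr θ
    obtain ⟨hRr, hr2⟩ := mem_dyadic hr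
    have h1 := htr c w B M d R r h θ hc4 hw hM hd hdP hh hR0 hhR hRr hr2
    have hexp : Real.exp (-c₁ * ell D ^ 10) ≤ 1 := by
      rw [Real.exp_le_one_iff]
      have : 0 ≤ ell D ^ 10 := by
        have := Real.log_natCast_nonneg D
        rw [ell]; positivity
      nlinarith
    have h2 : B * M * Real.exp (-c₁ * ell D ^ 10) ≤ B * M := by
      have : 0 ≤ B * M := mul_nonneg hB0 hM
      nlinarith [Real.exp_pos (-c₁ * ell D ^ 10)]
    calc ‖frakSGen D c w r h θ‖
        = ‖frakSstarGen D c w R r h θ + (frakSGen D c w r h θ - frakSstarGen D c w R r h θ)‖ := by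
          ring_nf
      _ ≤ ‖frakSstarGen D c w R r h θ‖ + ‖frakSGen D c w r h θ - frakSstarGen D c w R r h θ‖ :=
          norm_add_le _ _
      _ ≤ ‖frakSstarGen D c w R r h θ‖ + B * M := by linarith [h1.trans h2]
  -- sum over the block
  set T : Finset (Σ r : ℕ, DirichletCharacter ℂ r) := (dyadic R).sigma fun r =>
      (Finset.univ : Finset (DirichletCharacter ℂ r)).filter fun θ => θ.IsPrimitive with hTdef
  have hsum : (∑ r ∈ dyadic R, ∑ θ : DirichletCharacter ℂ r with θ.IsPrimitive,
      ‖frakSGen D c w r h θ‖) ≤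
      (∑ r ∈ dyadic R, ∑ θ : DirichletCharacter ℂ r with θ.IsPrimitive,
        ‖frakSstarGen D c w R r h θ‖) + (T.card : ℝ) * (B * M) := by
    rw [sum_filter_prim_eq_sum_sigma, sum_filter_prim_eq_sum_sigma, ← hTdef]
    calc ∑ x ∈ T, ‖frakSGen D c w x.1 h x.2‖
        ≤ ∑ x ∈ T, (‖frakSstarGen D c w R x.1 h x.2‖ + B * M) :=
          Finset.sum_le_sum fun x hx => hterm x.1 (Finset.mem_sigma.mp hx).1 x.2
      _ = ∑ x ∈ T, ‖frakSstarGen D c w R x.1 h x.2‖ + (T.card : ℝ) * (B * M) := by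
          rw [Finset.sum_add_distrib, Finset.sum_const, nsmul_eq_mul]
  have hcardT : (T.card : ℝ) ≤ 6 * R ^ 2 := card_sigma_dyadic_prim_le hR
  have hR32 : 0 ≤ R ^ (-(3 / 2 : ℝ)) := Real.rpow_nonneg hR0.le _
  -- `R^{−3/2}·6R²·BM = 6BM·R^{1/2} ≤ 6BM·(R^{1/2}P^{3/2} + R^{−1/2}P²)`
  have hhalf : R ^ (-(3 / 2 : ℝ)) * (6 * R ^ 2) = 6 * R ^ (1 / 2 : ℝ) := by
    have : R ^ (-(3 / 2 : ℝ)) * R ^ 2 = R ^ (1 / 2 : ℝ) := by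
      rw [← Real.rpow_natCast R 2, ← Real.rpow_add hR0]; norm_num
    calc R ^ (-(3 / 2 : ℝ)) * (6 * R ^ 2) = 6 * (R ^ (-(3 / 2 : ℝ)) * R ^ 2) := by ring
      _ = 6 * R ^ (1 / 2 : ℝ) := by rw [this]
  have htail : R ^ (-(3 / 2 : ℝ)) * ((T.card : ℝ) * (B * M)) ≤
      6 * B * M * (R ^ (1 / 2 : ℝ) * P ^ (3 / 2 : ℝ) + R ^ (-(1 / 2 : ℝ)) * P ^ 2) := by
    have hBM : 0 ≤ B * M := mul_nonneg hB0 hM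
    have hP32 : 1 ≤ P ^ (3 / 2 : ℝ) := Real.one_le_rpow hP1 (by norm_num)
    have hRh0 : 0 ≤ R ^ (1 / 2 : ℝ) := Real.rpow_nonneg hR0.le _
    have hx : 0 ≤ R ^ (-(1 / 2 : ℝ)) * P ^ 2 := by positivity
    calc R ^ (-(3 / 2 : ℝ)) * ((T.card : ℝ) * (B * M))
        ≤ R ^ (-(3 / 2 : ℝ)) * (6 * R ^ 2 * (B * M)) := by
          apply mul_le_mul_of_nonneg_left _ hR32
          exact mul_le_mul_of_nonneg_right hcardT hBM
      _ = 6 * B * M * (R ^ (1 / 2 : ℝ) * 1) := by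
          rw [show R ^ (-(3 / 2 : ℝ)) * (6 * R ^ 2 * (B * M)) =
            (R ^ (-(3 / 2 : ℝ)) * (6 * R ^ 2)) * (B * M) by ring, hhalf]; ring
      _ ≤ 6 * B * M * (R ^ (1 / 2 : ℝ) * P ^ (3 / 2 : ℝ) + R ^ (-(1 / 2 : ℝ)) * P ^ 2) := by
          apply mul_le_mul_of_nonneg_left _ (by positivity)
          nlinarith
  calc R ^ (-(3 / 2 : ℝ)) * ∑ r ∈ dyadic R, ∑ θ : DirichletCharacter ℂ r with θ.IsPrimitive,
        ‖frakSGen D c w r h θ‖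
      ≤ R ^ (-(3 / 2 : ℝ)) * ((∑ r ∈ dyadic R, ∑ θ : DirichletCharacter ℂ r with θ.IsPrimitive,
          ‖frakSstarGen D c w R r h θ‖) + (T.card : ℝ) * (B * M)) :=
        mul_le_mul_of_nonneg_left hsum hR32
    _ = R ^ (-(3 / 2 : ℝ)) * (∑ r ∈ dyadic R, ∑ θ : DirichletCharacter ℂ r with θ.IsPrimitive,
          ‖frakSstarGen D c w R r h θ‖) + R ^ (-(3 / 2 : ℝ)) * ((T.card : ℝ) * (B * M)) := by
        ring
    _ ≤ C * K * M * (h : ℝ) * ell D ^ (5190 + 5 * j ^ 2) *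
          (R ^ (1 / 2 : ℝ) * P ^ (3 / 2 : ℝ) + R ^ (-(1 / 2 : ℝ)) * P ^ 2) +
        6 * B * M * (R ^ (1 / 2 : ℝ) * P ^ (3 / 2 : ℝ) + R ^ (-(1 / 2 : ℝ)) * P ^ 2) :=
        add_le_add hblk htail
    _ = (C * K * M * (h : ℝ) * ell D ^ (5190 + 5 * j ^ 2) + 6 * B * M) *
          (R ^ (1 / 2 : ℝ) * P ^ (3 / 2 : ℝ) + R ^ (-(1 / 2 : ℝ)) * P ^ 2) := by ring

/-! ## IV. Instantiation helpers (appended by zl-libA-p6): the `τ₅(dl)`-form of the coefficient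
hypothesis — as (14.1) `|κ*(m)| ≤ Bτ₅(m)` delivers it for `c(l) = κ*(dl)` — and sub-families of the
primitive characters (the (14.8) majorant `rhs1417On` keeps only `θ ≠ χ` lifted to `Dr`) -/

/-- `τ_{j+1}(n) ≤ n^j` for `n ≥ 1` (from the recursion `τ_{j+1}(n) = Σ_{d∣n} τ_j(d)` and `d(n) ≤ n`).
[cite: Ivic1985, §1.6, p. 31 (recursion for d_k)] -/
theorem tau_succ_le_pow (j : ℕ) {n : ℕ} (hn : n ≠ 0) :
    MeanSquareMajorant.tau (j + 1) n ≤ (n : ℝ) ^ j := by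
  induction j generalizing n with
  | zero => rw [MeanSquareMajorant.tau_one_apply hn, pow_zero]
  | succ j ih =>
      rw [MeanSquareMajorant.tau_succ_apply]
      calc ∑ d ∈ n.divisors, MeanSquareMajorant.tau (j + 1) d
          ≤ ∑ _d ∈ n.divisors, (n : ℝ) ^ j := by
            refine Finset.sum_le_sum fun d hd => ?_
            have hd0 : d ≠ 0 := (Nat.pos_of_mem_divisors hd).ne'
            have hdn : (d : ℝ) ≤ n := by exact_mod_cast Nat.divisor_le hd
            exact (ih hd0).trans (pow_le_pow_left₀ (Nat.cast_nonneg d) hdn j)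
        _ = (n.divisors.card : ℝ) * (n : ℝ) ^ j := by rw [Finset.sum_const, nsmul_eq_mul]
        _ ≤ (n : ℝ) * (n : ℝ) ^ j := by
            gcongr; exact_mod_cast Nat.card_divisors_le_self n
        _ = (n : ℝ) ^ (j + 1) := by ring

/-- From `|c(l)| ≤ B·τ₅(dl)` (`d ≥ 1`; the shape (14.1) gives for `c(l) = κ*(dl)`): `B ≥ 0`, the
factored form `|c(l)| ≤ B·τ₅(d)·τ₅(l)` (`MeanSquareMajorant.tau_mul_le`) wanted by the `l`-sieve, and the
polynomial form `|c(l)| ≤ B·(dl)⁴` (`τ₅(n) ≤ n⁴`) wanted by the localisation `𝔰 ↦ 𝔰*`.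
[cite: Zhang2022LandauSiegel, §14 (14.1) p.76, tex L3828] -/
theorem coeff_bounds_of_le_tau_mul {c : ℕ → ℂ} {B : ℝ} {d : ℕ} (hd : 0 < d)
    (hc : ∀ l : ℕ, ‖c l‖ ≤ B * MeanSquareMajorant.tau 5 (d * l)) :
    0 ≤ B ∧ (∀ l : ℕ, ‖c l‖ ≤ B * MeanSquareMajorant.tau 5 d * MeanSquareMajorant.tau 5 l) ∧
      (∀ l : ℕ, ‖c l‖ ≤ B * ((d * l : ℕ) : ℝ) ^ 4) := by
  have hτd : 1 ≤ MeanSquareMajorant.tau 5 d := MeanSquareMajorant.one_le_tau (by norm_num) hd.ne'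
  have hB0 : 0 ≤ B := by
    have h1 := (norm_nonneg _).trans (hc 1)
    rw [mul_one] at h1
    nlinarith
  refine ⟨hB0, fun l => ?_, fun l => ?_⟩
  · calc ‖c l‖ ≤ B * MeanSquareMajorant.tau 5 (d * l) := hc l
      _ ≤ B * (MeanSquareMajorant.tau 5 d * MeanSquareMajorant.tau 5 l) :=
          mul_le_mul_of_nonneg_left (MeanSquareMajorant.tau_mul_le 5 d l) hB0
      _ = _ := by ring
  · rcases Nat.eq_zero_or_pos l with rfl | hl
    · have h0 : MeanSquareMajorant.tau 5 (d * 0) = 0 := by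
        rw [mul_zero]; exact ArithmeticFunction.map_zero
      calc ‖c 0‖ ≤ B * MeanSquareMajorant.tau 5 (d * 0) := hc 0
        _ = B * ((d * 0 : ℕ) : ℝ) ^ 4 := by rw [h0]; simp
    · have hdl : d * l ≠ 0 := Nat.mul_ne_zero hd.ne' hl.ne'
      calc ‖c l‖ ≤ B * MeanSquareMajorant.tau 5 (d * l) := hc l
        _ ≤ B * ((d * l : ℕ) : ℝ) ^ 4 :=
            mul_le_mul_of_nonneg_left (tau_succ_le_pow 4 hdl) hB0

/-- The tree's `Skeleton.finsetOf` of a predicate on a finite type is the filtered `univ` (so the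
`finsetOf {θ | …}` character sums of `Typed.Sec14.lhs148`/`rhs1417On` are `Finset.filter` sums).
[cite: Zhang2022LandauSiegel, §14 (14.8) p.79, tex L3945] -/
theorem finsetOf_setOf_eq_filter {α : Type*} [Fintype α] (p : α → Prop) [DecidablePred p] :
    finsetOf {a : α | p a} = (Finset.univ : Finset α).filter p := by
  ext a
  rw [mem_finsetOf (Set.toFinite _), Finset.mem_filter, Set.mem_setOf_eq]
  simp

open scoped Classical in
/-- **The per-block bound, `τ₅(dl)`-form** (the instance the §14 legs use: `j = 5`, `K = Bτ₅(d)`):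
there is an absolute `C ≥ 0` such that for all large `D`, all `c, w` with `|c(l)| ≤ Bτ₅(dl)` (all `l`),
`|w(p)| ≤ M` on `p ∼ P` (`M ≥ 0`), `1 ≤ d ≤ P`, `h ≥ 1`, `1 ≤ R`, `Rh ≤ P`:
`R^{−3/2} Σ_{R≤r<2R} Σ*_{θ mod r} ‖𝔰(r,h;θ)‖ ≤ C·B·M·τ₅(d)·h·𝓛⁵³¹⁵·(R^{1/2}P^{3/2} + R^{−1/2}P²)`
(`dyadic_block_bound_frakSGen` at `j = 5` with `coeff_bounds_of_le_tau_mul`; the additive `6BM` is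
absorbed since `τ₅(d), h, 𝓛 ≥ 1`). [cite: Zhang2022LandauSiegel, §7 p.39, tex L2055; §14 (14.8) p.79, tex L3962] -/
theorem dyadic_block_bound_frakSGen_tau5 :
    ∃ C : ℝ, 0 ≤ C ∧ ForAllLarge fun D _ _ =>
      ∀ (c w : ℕ → ℂ) (B M : ℝ) (d h : ℕ) (R : ℝ),
        (∀ l : ℕ, ‖c l‖ ≤ B * MeanSquareMajorant.tau 5 (d * l)) →
        (∀ p ∈ primeWindow D, ‖w p‖ ≤ M) → 0 ≤ M →
        0 < d → (d : ℝ) ≤ bigP D → 0 < h → 1 ≤ R → R * h ≤ bigP D →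
          R ^ (-(3 / 2 : ℝ)) * ∑ r ∈ dyadic R, ∑ θ : DirichletCharacter ℂ r with θ.IsPrimitive,
              ‖frakSGen D c w r h θ‖ ≤
            C * B * M * MeanSquareMajorant.tau 5 d * (h : ℝ) * ell D ^ 5315 *
              (R ^ (1 / 2 : ℝ) * bigP D ^ (3 / 2 : ℝ) + R ^ (-(1 / 2 : ℝ)) * bigP D ^ 2) := by
  obtain ⟨C, hC0, D₀, hblock⟩ := dyadic_block_bound_frakSGen 5
  refine ⟨C + 6, by linarith, max D₀ 3, fun D _ χ hD hq hp c w B M d h R hc hw hM hd hdP hh hR hRhP => ?_⟩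
  have hD3 : 3 ≤ D := le_trans (le_max_right _ _) hD
  obtain ⟨hB0, hcK, hc4⟩ := coeff_bounds_of_le_tau_mul hd hc
  set τ : ℝ := MeanSquareMajorant.tau 5 d with hτ
  have hτ1 : 1 ≤ τ := MeanSquareMajorant.one_le_tau (by norm_num) hd.ne'
  have hK0 : 0 ≤ B * τ := mul_nonneg hB0 (le_trans zero_le_one hτ1)
  have hcK' : ∀ l ∈ natI D (R * h), ‖c l‖ ≤ B * τ * MeanSquareMajorant.tau 5 l := fun l _ => hcK l
  have h1 := hblock D χ (le_trans (le_max_left _ _) hD) hq hp c w (B * τ) M B d R h hK0 hM hcK' hc4 hw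
    hd hdP hh hR hRhP
  have hℓ1 : 1 ≤ ell D := one_le_ell hD3
  have hh1 : (1 : ℝ) ≤ h := by exact_mod_cast hh
  have hP1 : 1 ≤ bigP D := one_le_bigP D
  have hR0 : 0 < R := by linarith
  set Z : ℝ := R ^ (1 / 2 : ℝ) * bigP D ^ (3 / 2 : ℝ) + R ^ (-(1 / 2 : ℝ)) * bigP D ^ 2 with hZ
  have hZ0 : 0 ≤ Z := by rw [hZ]; positivity
  have hpow : ell D ^ (5190 + 5 * 5 ^ 2) = ell D ^ 5315 := by norm_num
  rw [hpow] at h1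
  have hL1 : 1 ≤ ell D ^ 5315 := one_le_pow₀ hℓ1
  have hτhL : 1 ≤ τ * (h : ℝ) * ell D ^ 5315 := by
    calc (1 : ℝ) = 1 * 1 * 1 := by ring
      _ ≤ τ * (h : ℝ) * ell D ^ 5315 := by gcongr
  have hBM : 0 ≤ B * M := mul_nonneg hB0 hM
  have h6 : 6 * B * M ≤ 6 * B * M * (τ * (h : ℝ) * ell D ^ 5315) := by
    have : 6 * B * M * 1 ≤ 6 * B * M * (τ * (h : ℝ) * ell D ^ 5315) :=
      mul_le_mul_of_nonneg_left hτhL (by positivity)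
    linarith
  calc R ^ (-(3 / 2 : ℝ)) * ∑ r ∈ dyadic R, ∑ θ : DirichletCharacter ℂ r with θ.IsPrimitive,
          ‖frakSGen D c w r h θ‖
      ≤ (C * (B * τ) * M * (h : ℝ) * ell D ^ 5315 + 6 * B * M) * Z := h1
    _ ≤ (C * (B * τ) * M * (h : ℝ) * ell D ^ 5315 + 6 * B * M * (τ * (h : ℝ) * ell D ^ 5315)) * Z :=
        mul_le_mul_of_nonneg_right (by linarith) hZ0
    _ = (C + 6) * B * M * τ * (h : ℝ) * ell D ^ 5315 * Z := by ring

open scoped Classical in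
/-- **The per-block bound over a sub-family of the primitive characters** (any predicate `Q`, e.g. the
(14.8)/u017 condition "`θ ≠ χ`" as `changeLevel θ ≠ changeLevel χ`; the discarded terms are
non-negative), `τ₅(dl)`-form. [cite: Zhang2022LandauSiegel, §14 (14.8) p.79, tex L3945–L3963] -/
theorem dyadic_block_bound_frakSGen_tau5_filter :
    ∃ C : ℝ, 0 ≤ C ∧ ForAllLarge fun D _ _ =>
      ∀ (Q : (r : ℕ) → DirichletCharacter ℂ r → Prop) (c w : ℕ → ℂ) (B M : ℝ) (d h : ℕ) (R : ℝ),
        (∀ l : ℕ, ‖c l‖ ≤ B * MeanSquareMajorant.tau 5 (d * l)) →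
        (∀ p ∈ primeWindow D, ‖w p‖ ≤ M) → 0 ≤ M →
        0 < d → (d : ℝ) ≤ bigP D → 0 < h → 1 ≤ R → R * h ≤ bigP D →
          R ^ (-(3 / 2 : ℝ)) * ∑ r ∈ dyadic R,
              ∑ θ ∈ (Finset.univ : Finset (DirichletCharacter ℂ r)).filter
                  (fun θ => θ.IsPrimitive ∧ Q r θ), ‖frakSGen D c w r h θ‖ ≤
            C * B * M * MeanSquareMajorant.tau 5 d * (h : ℝ) * ell D ^ 5315 *
              (R ^ (1 / 2 : ℝ) * bigP D ^ (3 / 2 : ℝ) + R ^ (-(1 / 2 : ℝ)) * bigP D ^ 2) := by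
  obtain ⟨C, hC0, D₀, hall⟩ := dyadic_block_bound_frakSGen_tau5
  refine ⟨C, hC0, D₀, fun D _ χ hD hq hp Q c w B M d h R hc hw hM hd hdP hh hR hRhP => ?_⟩
  have h1 := hall D χ hD hq hp c w B M d h R hc hw hM hd hdP hh hR hRhP
  have hR0 : 0 < R := by linarith
  refine le_trans (mul_le_mul_of_nonneg_left ?_ (Real.rpow_nonneg hR0.le _)) h1
  refine Finset.sum_le_sum fun r _ => ?_
  refine Finset.sum_le_sum_of_subset_of_nonneg ?_ fun θ _ _ => norm_nonneg _
  intro θ hθ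
  rw [Finset.mem_filter] at hθ ⊢
  exact ⟨hθ.1, hθ.2.1⟩

end Literature.NumberTheory.LFunctions.Zhang2022.BErrorChain
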